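import Summits.BirchSwinnertonDyer.BirchSwinnertonDyer.Theses.PrintCFram
import Summits.BirchSwinnertonDyer.BirchSwinnertonDyer.Theorems.RamifiedSevenEllipticUnitsRubinFormulaZpBsdp
import Summits.BirchSwinnertonDyer.BirchSwinnertonDyer.Theorems.AdditiveRankOneBSDpOfExactIndexManin
import Summits.BirchSwinnertonDyer.Rank1Residual.X11b.BDPRouteOnTreeStepL
import Summits.BirchSwinnertonDyer.Rank1Residual.Partition.CornersCM
import Literature.NumberTheory.EllipticCurves.NonvanishingTwistsHoffsteinLuo
import Literature.NumberTheory.EllipticCurves.Kim2024.DefiniteSelmerStructure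
import HarnessLib

/-!
# Crux `PrintCFram.BottomClassIndexLawFiveLe` (stmt-BirchSwinnertonDyer-20372) — line `bipartite_toric_borel`
# (ideator seat `bsd-idea-7` g16, lens «complete»; PUBLISH-ONLY skeleton, NOT the line of record)

HONEST FRAMING. Nothing about BSD is proved here. Five `sorry`s, all inside `stub_*`; the composition
`BottomClassIndexLawFiveLe_of` is kernel-checked and concludes the crux BY NAME. The line of record is the LEAD's
`Lines/eisenstein_resource_bdp_line.lean` (registry v23, cell `bsd-print-cfram`); this file never touches the LEAD's
paths or stubs and is not `skeleton check`ed (W-79). BSD is not proved by any of this.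

THE CLASS. `W/ℚ` with CM by `𝓞_K`, `K = ℚ(√-p)`, `p ∈ {7, 11, 19, 43, 67, 163}` RAMIFIED in `K` (`CMRamified W p`),
`5 ≤ p`, `r_an(W) = 1`; `p² ∣ N_W` (additive, potentially supersingular), `ρ̄_{W,p}` BOREL (`W[𝔭]` a `G_ℚ`-line).

WHAT THIS LINE COMPLETES (lens «complete»: a published programme with an author-named gap). C.-H. Kim, *A higher
Gross–Zagier formula and the structure of Selmer groups* (TAMS 377 (2024) = arXiv:2203.12161; tree:
`Kim2024.thm523_natCard_selmerGroupPInfty_eq_pow_of_unitToricPeriod`, `…thm426…deepAdmissible`) reads the FULL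
STRUCTURE of `Sel(K'', E[p^∞])` off the BIPARTITE Euler system of Bertolini–Darmon 2005: the level-raised toric
periods `λ^bip_n = Σ_{[𝔞] ∈ Cl(K'')} f_{n}([ψ(𝔞)O])` of the mod-`p^k` Jacquet–Langlands eigenforms `f_n` on the
DEFINITE quaternion algebras `B_n` (`n` a square-free product of an odd number of admissible primes), with NO
`p`-adic `L`-function and NO anticyclotomic Iwasawa theory ("works even when … supersingular at `p`", Rem. 2.1).
Its printed hypotheses — `E` NON-CM, `ρ̄_{E,p}` SURJECTIVE, GOOD reduction at `p` (§2.1 (a)(d), Assumption 4.21) —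
all fail on the class, and that failure IS the crux: at a Borel prime the line of record's `p`-adic-analytic
devices stop at depth `0` (Kriz–Li reads `0 ≡ 0` on the IRREGULAR members, residue B1 = `stub_bsdp_of_level` +
`stub_bsdp_of_sha` of v23, «BSD_p on two rank-one CM-ramified subfamilies», no instrument on record).

THE LINE (p-adic-L-free, Λ-free). Over an auxiliary Heegner field `K'' ≠ K` (`d_{K''}` odd, `L(W^{d_{K''}},1) ≠ 0`,
Hoffstein–Luo; the additive `p` SPLITS in `K''`, so `N⁻ = 1`, `N⁺ = N_W ∋ p²`), the exact `p`-adic Heegner-index law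
`2·ord_p[W(K''):ℤP] = ord_p #Ш(W/K'') + 2·ord_p ∏ c_ℓ + 2·v_p(c(Dt))` is cut as KOLYVAGIN cuts it, not as upper/lower
`p`-adic `L`-bounds: UPPER = Kolyvagin's inequality at the Borel CM-ramified prime (`stub_kolyvaginUpper_borelCM`, the
statement SHARED verbatim with line `borel_heegner_squeeze` S2 — one target, proved once); LOWER = the half that
line recorded as «no mechanism at an additive Eisenstein prime», now WITH a mechanism in two typed pieces over the
tree's Brandt package (`Brandt.XiSetup`, `Brandt.ClassSet`, `Brandt.matrix`, `Brandt.IsGrossPoint`, `Brandt.toricPeriod`):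
* `stub_bipartiteLower_borelCM` — KIM'S STRUCTURE THEOREM IN RANK ONE AT THE BOREL ADDITIVE PRIME, length form: a UNIT
  level-raised toric period `λ^bip_n` (a non-zero mod-`p` `T_q`-eigenfunction with `W`'s eigenvalues, alone on its
  eigen-line, on the definite algebra of level `(N_W, n)`, `ν(n)` odd, with non-zero toric period at a conductor-`1`
  Gross point of `K''`) forces `∂^{(ν(n))}(λ^bip) = 0`, hence `#Ш(W/K'')[p^∞] = p^{2∂^{(1)}}` with `∂^{(1)} ≤ M₀` (first
  reciprocity law / "higher Gross–Zagier"), i.e. the socket `SchneiderFree.IndexLowerBoundLeAt W p K'' P (v_p c(Dt))`;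
* `stub_companionPeriodUnit_borelCM` — THE NEW LEVER («irregular companion period»): such a unit EXISTS for every class
  member and frame. Why one expects it exactly where Kriz–Li is silent: at an Eisenstein prime the `𝔪_W`-eigenspace of
  the mod-`p` Brandt module at an admissible level `n` is spanned by the reductions of the `n`-new level-raised forms
  (Ribet / Diamond–Taylor; Billerey–Menares 2016 for REDUCIBLE `ρ̄`, tree `EisensteinNewformLevelRaising*`) — the
  `𝔪_W`-generalised eigenspace `V_n` is NON-ZERO iff a cuspidal `n`-new companion `g ≡ f_W (mod 𝔭)` exists; there is no
  Eisenstein vector on the definite side (one-dimensional forms are `χ∘Nrd`; `W`'s eigenvalues `φ(q)(1 + (q/p))`,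
  `φ = χ_e ω^{(p+1)/4} ∉ {1, ω}`). Regular vs irregular is a congruence of VALUES (Gross's formula + Vatsal's Eisenstein
  congruence, Duke 2003 §4; Kriz–Li 2019 §5): `λ_n² ≐ L^{alg}(g_n/K'',1) ≡ ∏_ψ B_{1,ψ} (mod 𝔭)`, `ψ` odd among
  `{φ⁻¹ω, φ, φ⁻¹ω·ε_{K''}, φ·ε_{K''}}`, whose `K''`-independent factor `B_{1,φ⁻¹ω}` is a `p`-unit EXACTLY on the regular
  (Kriz–Li) locus. So on REGULAR members the value congruence already yields a unit (no stronger than Kriz–Li), and on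
  IRREGULAR members (where that Bernoulli factor and every `p`-adic `L`-value of the family vanish mod `p`) it only says
  `λ_n ≡ 0` to first order — the claim «irregular companion period» is that some admissible level carries a companion
  whose toric period is nevertheless a unit (cheapest falsifier: Brandt-module linear algebra at `p = 7` for the
  `49a`-twists, one admissible prime; pre-registered readings in the line card).
The partner `W^{d_{K''}}` has `r_an = 0` and CM (`BSD_p` by Burungale–Flach, `bsdp_cm_rankZero`); the Manin-robust socket
`SchneiderFree.Exact.bsdp_of_exactIndexManin_of_partner_bsdp` gives `BSDp W p` for EVERY class member (so in
particular the v23 B1 slots `stub_bsdp_of_level` / `stub_bsdp_of_sha`, by dropping their extra binders — adoption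
path for the LEAD, not exercised here), and `RubinFormulaZpBsdp.ramifiedCMBottomClassIndexLawAtZp_of_bsdp` the crux.

BARRIERS (catalogue `Literature/Barriers/BirchSwinnertonDyer/`). `CMRankOneAtRamifiedPrime` (A)–(E) and
`AnomalousHeegnerLogWall` quantify over `p`-ADIC `L`-FUNCTIONS / `U_p`-eigen-objects / `log_ω` — none occurs here.
`TraceZeroHeegnerTowerAtAdditiveSplitP` kills Λ-adic (VERTICAL, `p`-power conductor) Heegner families at the additive
split `p`; the bipartite system is HORIZONTAL (conductor `1`, levels `n` prime to `Np`). `ReducibleAnticyclotomicAtBadP`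
concerns anticyclotomic main conjectures; none is used. `EulerSystemBigImageAtSmallImage` DOES bite: both research
stubs need reducible-image Čebotarev choices of admissible primes (recorded in their docstrings as the failure mode;
the bet is that `W(K'')[p] = 0`, `p ≥ 7`, and the abundance of admissible primes of type `φ(Frob_q) = ±1` suffice,
as in the Eisenstein-prime descents of Castella–Grossi–Lee–Skinner / BCGS 2023 at GOOD ORDINARY `p`).
`NoAdmissiblePrimesCMInert` concerns `K`-INERT `p` with `K` the CM field as Heegner field; here the Heegner field is
the auxiliary `K''` and admissible primes are Čebotarev-abundant. `StringentKolyvaginCapsAtMax`: Tamagawa exponents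
are `0` on the class (`c_ℓ ≤ 4 < p`), Manin slack is carried explicitly.

STUBS (5): `stub_prints_bip` (8 refereed facts, by name; = squeeze S0) · `stub_heegnerFrame_bip` (assembly, size M;
= squeeze S1) · `stub_kolyvaginUpper_borelCM` (research-M; SHARED with squeeze S2, verbatim) · `stub_bipartiteLower_borelCM`
(research-L; Kim Thm. 4.24/4.26 in rank one at a Borel additive prime) · `stub_companionPeriodUnit_borelCM` (research-L,
hardest, the lever). Composition: `BottomClassIndexLawFiveLe_of_hyps` / `BottomClassIndexLawFiveLe_of` (+ `bsdp_of_hyps`, the all-members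
`BSDp` corollary modulo GZK).

References: [Kim2024] Thms. 4.22, 4.24, 4.26, Rem. 2.1, §4.2.3 (arXiv:2203.12161v7); [BertoliniDarmon2005] Thm. 4.1,
§§2–3; [GrossLMS1991] §§3–5; [Kolyvagin1991MathAnn] Thm. 4; [McCallumLMS1991] Thm. 5.8; [WZhang2014] Thms. 4.3, 6.4,
11.2; [BurungaleEtAl2026] = arXiv:2312.09301 Thms. 1–2; [CastellaGrossiLeeSkinner2022] Thm. 5.1.1;
[BillereyMenares2016]; [Vatsal2004] Thm. 6.4, (7-5); [Gross1987] §§3, 11; [JetchevSkinnerWan2017] §7.4.1;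
[GrossZagier1986] I.(6.3), (7.3); [BurungaleFlach2024] Thm. 1.1; [HoffsteinLuo1997]; [Cassels1965ArithmeticVIII];
[BurungaleKobayashiNakamuraOta2026] §1.4.
-/

set_option autoImplicit false
-- `…Cruxes.<CruxDecl>.<Slug>` is the mandated namespace of a crux line (CRUX WORKFILES); it repeats a path component.
set_option linter.dupNamespace false

noncomputable section

open scoped Classical Matrix
open NumberField IsDedekindDomain Field WeierstrassCurve
open Literature.NumberTheory.Automorphic
open Literature.NumberTheory.EllipticCurves Literature.NumberTheory.EllipticCurves.ModularForms
open Literature.NumberTheory.EllipticCurves.Rank1Residual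
open Summit.BirchSwinnertonDyer.Rank1Residual Summit.BirchSwinnertonDyer.Rank1Residual.X12.O11
open Summit.BirchSwinnertonDyer.BirchSwinnertonDyer.Theorems.SchneiderFree
open Summit.BirchSwinnertonDyer.BirchSwinnertonDyer.Theorems.RamifiedSevenEllipticUnits

namespace Summit.BirchSwinnertonDyer.BirchSwinnertonDyer.Cruxes.BottomClassIndexLawFiveLe.BipartiteToricBorel

/-- **S0 · PRINT (= line `borel_heegner_squeeze` S0, shared).** The eight refereed inputs, each a named Literature fact
consumed BY NAME: Gross–Zagier I.(6.3) (`gross_zagier`), Kolyvagin's finiteness theorem (`kolyvagin`), modularity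
(`hasEntireLFunction_rat`, `exists_isNewformOf`), Gross–Zagier I.(7.3), Cassels' isogeny invariance of the BSD
quotient, Burungale–Flach (BSD for CM curves with `L(E,1) ≠ 0`), Hoffstein–Luo non-vanishing of a twist with
prescribed splitting. Size: print. [cite: GrossZagier1986, I.(6.3), (7.3)] [cite: BurungaleFlach2024, Thm. 1.1] -/
theorem stub_prints_bip :
    (∀ (N : ℕ) [NeZero N] (W : WeierstrassCurve ℚ) (K : Type) [Field K] [NumberField K], gross_zagier N W K) ∧
    (∀ (N : ℕ) [NeZero N] (W : WeierstrassCurve ℚ) (K : Type) [Field K] [NumberField K], kolyvagin N W K) ∧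
    hasEntireLFunction_rat ∧ GrossZagier1986_thm_I_7_3 ∧ bsdRHS_eq_of_isIsogenous ∧
    bsdTriple_of_hasCM_of_L_one_ne_zero ∧ exists_isNewformOf ∧ HoffsteinLuo1997_exists_twist_L_one_ne_zero := by
  sorry

/-- **S1 · ASSEMBLY (size M; = line `borel_heegner_squeeze` S1, shared) — a full anticyclotomic Heegner frame exists for
every class member**, FROM the two existence facts named as antecedents (modularity `exists_isNewformOf`;
Hoffstein–Luo ⇒ a twist with odd fundamental discriminant, prescribed splitting and `L ≠ 0`): an imaginary quadratic
`K''` with `d_{K''}` odd, Heegner for `N = N_W` (so the additive `p ∣ N` splits in `K''`), `p ∤ #𝓞_{K''}^×`,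
`L(W^{d_{K''}},1) ≠ 0`; a parametrisation datum `Dt` at level `N`, a Heegner datum `H`, an embedding `ι`, the Heegner
point `P ∈ W(K'')`, and a globally minimal model `Wd` of the twist, again CM. Why it might fail: it should not — every
piece is a tree theorem or a named fact. [cite: HoffsteinLuo1997, Thm. 1] [cite: GrossZagier1986, I.(6.3)] -/
theorem stub_heegnerFrame_bip :
    exists_isNewformOf → HoffsteinLuo1997_exists_twist_L_one_ne_zero →
    ∀ (W : WeierstrassCurve ℚ) [W.IsElliptic] [W.IsGloballyMinimal] (p : ℕ) [Fact p.Prime],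
      W.HasCM → CMRamified W p → 5 ≤ p → W.analyticRank = 1 →
      ∃ (N : ℕ) (_ : NeZero N) (K : Type) (_ : Field K) (_ : NumberField K)
        (Dt : ModularParametrizationData W N) (H : HeegnerDatum N (NumberField.discr K)) (ι : K →+* ℂ)
        (P : (W.baseChange K).toAffine.Point) (Wd : WeierstrassCurve ℚ) (_ : Wd.IsElliptic)
        (_ : Wd.IsGloballyMinimal),
        W.conductorNorm ℤ = N ∧ p ∣ N ∧ IsImaginaryQuadratic K ∧ Odd (NumberField.discr K) ∧
        ¬ p ∣ Units.torsionOrder K ∧ SatisfiesHeegnerHypothesis N K ∧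
        (W.quadraticTwist (NumberField.discr K : ℚ)).entireLFunction 1 ≠ 0 ∧
        WeierstrassCurve.Affine.Point.map ι.toRatAlgHom P = heegnerPointComplex Dt H ∧
        (∃ C : VariableChange ℚ, C • W.quadraticTwist (NumberField.discr K : ℚ) = Wd) ∧ Wd.HasCM := by
  sorry

/-- **S2u · RESEARCH-M (SHARED VERBATIM with line `borel_heegner_squeeze` S2 — one target, proved once) — Kolyvagin's
inequality at the BOREL CM-ramified prime, Tamagawa-sharpened and at Manin slack `v_p(c(Dt))`:**
`ord_p #Ш(W/K'') + 2·ord_p ∏ c_ℓ(W) + 2·v_p(c) ≤ 2·ord_p [W(K'') : ℤ·P]` (`SchneiderFree.Upper.IndexUpperBoundLeAt`).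
In print ONLY under hypotheses the class violates (`ρ̄` onto: Kolyvagin/Gross; irreducible + `p² ∤ N`: Cha; non-CM:
GJPST Thm. 3.7 / Miller Thm. 5.3; good ordinary Eisenstein: CGLS Thm. 5.1.1). Why it might fail: a Selmer class with
values in the `τ`-eigenline `W[𝔭]` of the wrong sign may be invisible to every Kolyvagin prime (Gross Prop. 5.3
analogue), and `p² ∣ N` changes the finite/singular bookkeeping at `v ∣ p`.
[cite: GrigorovJorzaPatrikisSteinTarnita2009, Thm. 3.7] [cite: CastellaGrossiLeeSkinner2022, Thm. 5.1.1]
[cite: JetchevSkinnerWan2017, §7.4.1] -/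
theorem stub_kolyvaginUpper_borelCM :
    ∀ (W : WeierstrassCurve ℚ) [W.IsElliptic] [W.IsGloballyMinimal] (p : ℕ) [Fact p.Prime],
      W.HasCM → CMRamified W p → 5 ≤ p → W.analyticRank = 1 →
      ∀ (N : ℕ) [NeZero N] (K : Type) [Field K] [NumberField K]
        (Dt : ModularParametrizationData W N) (H : HeegnerDatum N (NumberField.discr K)) (ι : K →+* ℂ)
        (P : (W.baseChange K).toAffine.Point),
        W.conductorNorm ℤ = N → IsImaginaryQuadratic K → Odd (NumberField.discr K) →
        ¬ p ∣ Units.torsionOrder K → SatisfiesHeegnerHypothesis N K →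
        (W.quadraticTwist (NumberField.discr K : ℚ)).entireLFunction 1 ≠ 0 →
        WeierstrassCurve.Affine.Point.map ι.toRatAlgHom P = heegnerPointComplex Dt H →
        ¬ IsOfFinAddOrder P →
        Upper.IndexUpperBoundLeAt W p K P (padicValNat p Dt.c.natAbs) := by
  sorry

/-- **S2 · RESEARCH-L — Kim's bipartite STRUCTURE THEOREM in RANK ONE at the Borel CM-ramified additive prime, length
form, read as the LOWER Heegner-index inequality.** For a class member and a frame over `K''` (binders as in S2u),
ANY definite unit datum — `n` square-free with an ODD number of prime factors, each `1`-admissible for `(W, K'', p)`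
(`q ∤ Np`, `q` inert in `K''`, `p ∤ q² − 1`, `a_q(W) ≡ ±(q+1) (mod p)`; Kim §2.4); a Brandt set-up `Sₙ` of type
`(N_W, n)` (the definite quaternion algebra ramified exactly at `n·∞` with an Eichler order of level `N_W ∋ p²`);
a conductor-`1` Gross point `ψₙ` of `K''`; a non-zero mod-`p` `T_q`-eigenfunction `fₙ : Cls(Sₙ.O) → 𝔽_p` with the
eigenvalues `a_q(W)` (`q ∤ N n p`) ALONE on its eigen-line (Kim's `f_{n} mod p`, Thm. 4.22) whose toric period
`λ^bip_n = Σ_{[𝔞]} fₙ([ψₙ(𝔞)O])` is NON-ZERO — forces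
`2·ord_p [W(K'') : ℤ·P] ≤ ord_p #Ш(W/K'') + 2·ord_p ∏ c_ℓ(W) + 2·v_p(c(Dt))` (`SchneiderFree.IndexLowerBoundLeAt`).
Printed for `E` non-CM, `ρ̄_{E,p}` onto, `p` good (Kim 2024 Thm. 4.24 / 4.26 with the first reciprocity law of
Bertolini–Darmon 2005 Thm. 4.1: `∂^{(ν(n))} = 0 ⇒ #Ш[p^∞] = p^{2∂^{(1)}}`, `∂^{(1)} ≤ ord_p[E(K''):ℤ y_{K''}]`); here
`W` has CM, `ρ̄` is Borel, `p² ∣ N⁺`. Why it might fail: Eisenstein Selmer classes (from the class groups cut out by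
`φ = χ_e ω^{(p+1)/4}` and `ωφ⁻¹`) are locally trivial at every admissible prime of type `φ(Frob_q) = ±q`, so the
structure theorem needs admissible primes of type `φ(Frob_q) = ±1` that SEE those classes (reducible-image Čebotarev,
barrier `EulerSystemBigImageAtSmallImage`) and the freeness of the bipartite system mod `p^k` (Kim Rem. 4.27 (1)); at
`v ∣ p` the local condition is the Kummer image of `W(K''_v)` at an ADDITIVE place (`W₀(K''_v) = Ŵ(𝔪_v)` torsion-free
pro-`p`, `c_p ≤ 4 < p`), where Bertolini–Darmon's reciprocity laws (printed for `p ∤ N`) must be re-derived with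
`p² ∣ N⁺` in the level (the geometric inputs — Čerednik–Drinfeld, Ihara, Ribet's sequence — live at `q ≠ p`). In RANK
ONE over a Heegner `K''` (`ν(N⁻) = 0`) the unit `λ^bip_n` (`ν(n)` odd) feeds the Heegner-point Kolyvagin system below it
through the SECOND reciprocity law (`loc_q κ_{n/q} ↔ λ_n`, W. Zhang's mechanism), so the statement is really
«Kolyvagin–McCallum structure theorem (McCallum Thm. 5.8) + second reciprocity at a Borel additive prime».
[cite: Kim2024, Thm. 4.24, Thm. 4.26, §4.2.3 (arXiv:2203.12161v7)] [cite: BertoliniDarmon2005, Thm. 4.1]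
[cite: JetchevSkinnerWan2017, §7.4.1] -/
theorem stub_bipartiteLower_borelCM :
    ∀ (W : WeierstrassCurve ℚ) [W.IsElliptic] [W.IsGloballyMinimal] (p : ℕ) [Fact p.Prime],
      W.HasCM → CMRamified W p → 5 ≤ p → W.analyticRank = 1 →
      ∀ (N : ℕ) [NeZero N] (K : Type) [Field K] [NumberField K]
        (Dt : ModularParametrizationData W N) (H : HeegnerDatum N (NumberField.discr K)) (ι : K →+* ℂ)
        (P : (W.baseChange K).toAffine.Point),
        W.conductorNorm ℤ = N → IsImaginaryQuadratic K → Odd (NumberField.discr K) →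
        ¬ p ∣ Units.torsionOrder K → SatisfiesHeegnerHypothesis N K →
        (W.quadraticTwist (NumberField.discr K : ℚ)).entireLFunction 1 ≠ 0 →
        WeierstrassCurve.Affine.Point.map ι.toRatAlgHom P = heegnerPointComplex Dt H →
        ¬ IsOfFinAddOrder P →
        ∀ (n : ℕ) (Sₙ : Brandt.XiSetup N n) [Fintype (Brandt.ClassSet Sₙ.O)]
          (ψₙ : K →ₐ[ℚ] Sₙ.D) (fₙ : Brandt.ClassSet Sₙ.O → ZMod p),
          Brandt.IsGrossPoint Sₙ.O ψₙ Sₙ.O →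
          Squarefree n → Odd n.primeFactors.card →
          (∀ q ∈ n.primeFactors, ¬ q ∣ N * p ∧
            (((Ideal.span {(q : ℤ)}).primesOver (𝓞 K)).ncard ≠ 2 ∧ ¬ (q : ℤ) ∣ NumberField.discr K) ∧
            ¬ (p : ℤ) ∣ (q : ℤ) ^ 2 - 1 ∧
            ((p : ℤ) ∣ W.LFunction q - (q + 1) ∨ (p : ℤ) ∣ W.LFunction q + (q + 1))) →
          fₙ ≠ 0 →
          (∀ q : ℕ, q.Prime → ¬ q ∣ N * n * p →
            fₙ ᵥ* (Brandt.matrix Sₙ.O q).map (Int.cast : ℤ → ZMod p) = ((W.LFunction q : ℤ) : ZMod p) • fₙ) →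
          (∀ g : Brandt.ClassSet Sₙ.O → ZMod p,
            (∀ q : ℕ, q.Prime → ¬ q ∣ N * n * p →
              g ᵥ* (Brandt.matrix Sₙ.O q).map (Int.cast : ℤ → ZMod p) = ((W.LFunction q : ℤ) : ZMod p) • g) →
            ∃ c : ZMod p, g = c • fₙ) →
          Brandt.toricPeriod Sₙ.O ψₙ Sₙ.O fₙ ≠ 0 →
          IndexLowerBoundLeAt W p K P (padicValNat p Dt.c.natAbs) := by
  sorry

/-- **S3 · RESEARCH-L (hardest; THE NEW LEVER «irregular companion period») — a UNIT level-raised toric period EXISTS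
for every class member and frame:** there are a square-free `n` with an odd number of prime factors, all `1`-admissible
for `(W, K'', p)`, a Brandt set-up `Sₙ` of type `(N_W, n)`, a conductor-`1` Gross point `ψₙ` of `K''` and a non-zero
mod-`p` `T_q`-eigenfunction `fₙ` with `W`'s eigenvalues, alone on its eigen-line, whose toric period is non-zero in
`𝔽_p` (Kim's `∂^{(∞)}(λ^bip) = 0` exhibited at ONE level; the bipartite form of Kolyvagin's conjecture `M_∞ = 0`,
which is a THEOREM at good ordinary Eisenstein `p`: Burungale–Castella–Grossi–Skinner, arXiv:2312.09301 Thm. 2, via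
IMC — no IMC exists here). Mechanism proposed (line card): Eisenstein level raising for reducible `ρ̄`
(Billerey–Menares 2016, tree `EisensteinNewformLevelRaising*`) makes the `𝔪_W`-generalised eigenspace of the mod-`p`
Brandt module non-zero at admissible levels (cuspidal companions `g ≡ f_W`; no Eisenstein vector exists on the definite
side); the companions' toric periods satisfy the VALUE congruence `λ_n² ≐ L^{alg}(g_n/K'',1) ≡ ∏ B_{1,ψ} (mod 𝔭)`
(Gross + Vatsal 2003 §4, Kriz–Li 2019 §5), a unit exactly on the REGULAR locus (for a suitable `K''`); on IRREGULAR
members the Eisenstein value vanishes and the claim is that some companion at some admissible level nevertheless has a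
unit toric period. Why it might fail: Eisenstein MULTIPLICITY ONE mod `p` on definite class sets can fail at every
admissible level (Ribet–Yoo / Wake–Wang-Erickson phenomena at non-square-free `N⁺ ∋ p²`), making "alone on its
eigen-line" unsatisfiable — FALLBACK (line card v1.2): `fₙ` = reduction of a characteristic-zero eigenvector `G` of a
level-raised newform in the lattice reducing to the non-split `W[p]`, same conclusion; and the companion periods may all
vanish for a member (the pre-registered `p = 7` instrument reads this); `p ∣ h_{K''}` is avoided by re-choosing `K''`.
[cite: Kim2024, Thm. 4.22 and §4.2.3] [cite: BurungaleEtAl2026, Thm. 2 (arXiv:2312.09301)]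
[cite: BillereyMenares2016, Thm. 1] [cite: Vatsal2004, Thm. 6.4] -/
theorem stub_companionPeriodUnit_borelCM :
    ∀ (W : WeierstrassCurve ℚ) [W.IsElliptic] [W.IsGloballyMinimal] (p : ℕ) [Fact p.Prime],
      W.HasCM → CMRamified W p → 5 ≤ p → W.analyticRank = 1 →
      ∀ (N : ℕ) [NeZero N] (K : Type) [Field K] [NumberField K]
        (Dt : ModularParametrizationData W N) (H : HeegnerDatum N (NumberField.discr K)) (ι : K →+* ℂ)
        (P : (W.baseChange K).toAffine.Point),
        W.conductorNorm ℤ = N → IsImaginaryQuadratic K → Odd (NumberField.discr K) →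
        ¬ p ∣ Units.torsionOrder K → SatisfiesHeegnerHypothesis N K →
        (W.quadraticTwist (NumberField.discr K : ℚ)).entireLFunction 1 ≠ 0 →
        WeierstrassCurve.Affine.Point.map ι.toRatAlgHom P = heegnerPointComplex Dt H →
        ¬ IsOfFinAddOrder P →
        ∃ (n : ℕ) (Sₙ : Brandt.XiSetup N n) (_ : Fintype (Brandt.ClassSet Sₙ.O))
          (ψₙ : K →ₐ[ℚ] Sₙ.D) (fₙ : Brandt.ClassSet Sₙ.O → ZMod p),
          Brandt.IsGrossPoint Sₙ.O ψₙ Sₙ.O ∧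
          Squarefree n ∧ Odd n.primeFactors.card ∧
          (∀ q ∈ n.primeFactors, ¬ q ∣ N * p ∧
            (((Ideal.span {(q : ℤ)}).primesOver (𝓞 K)).ncard ≠ 2 ∧ ¬ (q : ℤ) ∣ NumberField.discr K) ∧
            ¬ (p : ℤ) ∣ (q : ℤ) ^ 2 - 1 ∧
            ((p : ℤ) ∣ W.LFunction q - (q + 1) ∨ (p : ℤ) ∣ W.LFunction q + (q + 1))) ∧
          fₙ ≠ 0 ∧
          (∀ q : ℕ, q.Prime → ¬ q ∣ N * n * p →
            fₙ ᵥ* (Brandt.matrix Sₙ.O q).map (Int.cast : ℤ → ZMod p) = ((W.LFunction q : ℤ) : ZMod p) • fₙ) ∧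
          (∀ g : Brandt.ClassSet Sₙ.O → ZMod p,
            (∀ q : ℕ, q.Prime → ¬ q ∣ N * n * p →
              g ᵥ* (Brandt.matrix Sₙ.O q).map (Int.cast : ℤ → ZMod p) = ((W.LFunction q : ℤ) : ZMod p) • g) →
            ∃ c : ZMod p, g = c • fₙ) ∧
          Brandt.toricPeriod Sₙ.O ψₙ Sₙ.O fₙ ≠ 0 := by
  sorry

/-- **All-members corollary (kernel-checked GIVEN the five stub statements as hypotheses — `type_of%` of the stubs, so the
text cannot drift; axioms standard): modulo GZK (the crux's own antecedent), `BSDp W p` for EVERY class member** —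
hence in particular the v23 B1 slots `stub_bsdp_of_level` / `stub_bsdp_of_sha` of the line of record (drop their extra
binders; adoption path for the LEAD, not exercised here). Route: frame (S1) ↦ `P` non-torsion (Gross–Zagier, tree) ↦
UPPER (S2u) ↦ unit datum (S3) ↦ LOWER (S2) ↦ exact index law at Manin slack `v_p(c)` + CM rank-zero partner
(Burungale–Flach) ↦ `SchneiderFree.Exact.bsdp_of_exactIndexManin_of_partner_bsdp`. BSD is not proved by this. -/
theorem bsdp_of_hyps
    (hS0 : type_of% @stub_prints_bip) (hS1 : type_of% @stub_heegnerFrame_bip)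
    (hS2u : type_of% @stub_kolyvaginUpper_borelCM) (hS2 : type_of% @stub_bipartiteLower_borelCM)
    (hS3 : type_of% @stub_companionPeriodUnit_borelCM) :
    rank_eq_analyticRank_of_analyticRank_le_one →
    ∀ (W : WeierstrassCurve ℚ) [W.IsElliptic] [W.IsGloballyMinimal] (p : ℕ) [Fact p.Prime],
      W.HasCM → CMRamified W p → 5 ≤ p → W.analyticRank = 1 → BSDp W p := by
  obtain ⟨hGZ, hKo, hmod, hGZ73, hCassels, hBF, hnf, hHL⟩ := hS0
  intro hGZK W _ _ p _ hCM hram h5 hr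
  have hpP : p.Prime := Fact.out
  have hp2 : p ≠ 2 := by
    rintro rfl
    omega
  obtain ⟨N, _, K, _, _, Dt, H, ι, P, Wd, _, _, hN, hpN, hK, hodd, hw, hHH, hLd, hP, hC, hWdCM⟩ :=
    hS1 hnf hHL W p hCM hram h5 hr
  have hPinf : ¬ IsOfFinAddOrder P :=
    X11b.not_isOfFinAddOrder_of_heegner_of_analyticRank_eq_one W N K Dt H ι P (hGZ N W K) hmod hr hK hHH hLd hP
  -- UPPER: Kolyvagin's inequality at the Borel CM-ramified prime (shared with `borel_heegner_squeeze` S2)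
  have hup : Upper.IndexUpperBoundLeAt W p K P (padicValNat p Dt.c.natAbs) :=
    hS2u W p hCM hram h5 hr N K Dt H ι P hN hK hodd hw hHH hLd hP hPinf
  -- THE LEVER: a unit level-raised toric period at some odd definite level `n`
  obtain ⟨n, Sₙ, instF, ψₙ, fₙ, hψ, hsq, hoddn, hadm, hf0, heig, halone, hunit⟩ :=
    hS3 W p hCM hram h5 hr N K Dt H ι P hN hK hodd hw hHH hLd hP hPinf
  -- LOWER: Kim's bipartite structure theorem in rank one, length form
  have hlo : IndexLowerBoundLeAt W p K P (padicValNat p Dt.c.natAbs) :=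
    @hS2 W _ _ p _ hCM hram h5 hr N _ K _ _ Dt H ι P hN hK hodd hw hHH hLd hP hPinf n Sₙ instF ψₙ fₙ hψ hsq hoddn
      hadm hf0 heig halone hunit
  -- the rank-zero CM partner: `L(Wd, 1) ≠ 0`, hence `r_an(Wd) = 0`, hence `BSD_p(Wd)` (Burungale–Flach)
  obtain ⟨Cd, hCd⟩ := hC
  have hD0 : (NumberField.discr K : ℚ) ≠ 0 := by exact_mod_cast NumberField.discr_ne_zero K
  haveI : (W.quadraticTwist (NumberField.discr K : ℚ)).IsElliptic := W.isElliptic_quadraticTwist hD0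
  have hLd1 : Wd.entireLFunction 1 ≠ 0 := by rw [← hCd, entireLFunction_smul]; exact hLd
  have hrd : Wd.analyticRank = 0 := analyticRank_eq_zero_of_entireLFunction_one_ne_zero Wd hLd1
  have hWd : BSDp Wd p := bsdp_cm_rankZero hBF hmod hWdCM hrd
  exact Exact.bsdp_of_exactIndexManin_of_partner_bsdp hGZ hKo hGZK hmod hGZ73 W p N K Dt H ι P Wd hr hN hpN hK hodd
    hw hHH hLd hP ⟨Cd, hCd⟩ hp2 hlo hup hWd

/-- **COMPOSITION, hypothesis-taking form `BottomClassIndexLawFiveLe_of_hyps` (kernel-checked, axioms standard; the five stub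
STATEMENTS as binders via `type_of%`):
S0 → S1 → S2u → S2 → S3 → the crux BY NAME.** `BSDp W p` on every member (`bsdp_of_hyps`) ↦ Cassels VIII.1.3 across the
CM isogeny class ↦ Rubin's exact index law at `ℤ_p` (`RubinFormulaZpBsdp.ramifiedCMBottomClassIndexLawAtZp_of_bsdp`).
Nothing about BSD is proved: the five stubs are `sorry`. [cite: Cassels1965ArithmeticVIII, Thm. 1.3]
[cite: RubinCM1998, Thm. 9] -/
theorem BottomClassIndexLawFiveLe_of_hyps
    (hS0 : type_of% @stub_prints_bip) (hS1 : type_of% @stub_heegnerFrame_bip)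
    (hS2u : type_of% @stub_kolyvaginUpper_borelCM) (hS2 : type_of% @stub_bipartiteLower_borelCM)
    (hS3 : type_of% @stub_companionPeriodUnit_borelCM) :
    Summit.BirchSwinnertonDyer.BirchSwinnertonDyer.Theses.PrintCFram.BottomClassIndexLawFiveLe := by
  obtain ⟨-, -, hmod, -, hCassels, -, -, -⟩ := id hS0
  intro hGZK W _ _ p _ hCM hram h5 hr
  exact RubinFormulaZpBsdp.ramifiedCMBottomClassIndexLawAtZp_of_bsdp hCassels hmod hGZK hr.le
    (bsdp_of_hyps hS0 hS1 hS2u hS2 hS3 hGZK W p hCM hram h5 hr)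

/-- **COMPOSITION `BottomClassIndexLawFiveLe_of`: the registered-shape form — the five `sorry`'d stubs plugged into
`BottomClassIndexLawFiveLe_of_hyps` (so it DEPENDS ON `sorryAx` until the stubs are proved; it certifies only that the
stub set concludes the crux BY NAME).** -/
theorem BottomClassIndexLawFiveLe_of :
    Summit.BirchSwinnertonDyer.BirchSwinnertonDyer.Theses.PrintCFram.BottomClassIndexLawFiveLe :=
  BottomClassIndexLawFiveLe_of_hyps stub_prints_bip stub_heegnerFrame_bip stub_kolyvaginUpper_borelCM
    stub_bipartiteLower_borelCM stub_companionPeriodUnit_borelCM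

end Summit.BirchSwinnertonDyer.BirchSwinnertonDyer.Cruxes.BottomClassIndexLawFiveLe.BipartiteToricBorel

end
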